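/-
Copyright (c) 2026 the pub-hodgecm-mathlib formalisation cell (harness21).  Prover seat hodgecm-mathlib-F0P3-p01 (g32), Track A «(D-RAM) FOUR-FRAME», unit U2H, census leaf
(ρ2b′-X) — T5b «TORIC LEVEL CENSUS, type RamK»: THE EXPLICIT ANISOTROPIC TABLE (sheet (S4)).  2026-09-04.
-/
import Summits.HodgeConjecture.HodgeConjecture.Theorems.F0P3cDyRamToricCensusDefs       -- ★ p857239 (LH4-p12 (g4)): `levelSet`
import Summits.HodgeConjecture.HodgeConjecture.Theorems.F0P3cDyRamToricLevelCensusUnr    -- ★ (LH4-p08 (g4)) T5a HEAD: `levelSet_eq_setOf` BY NAME; brings ★ `QuadraticOrderLevelClasses`, `QuadraticOrderTorusIndices`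
import Summits.HodgeConjecture.HodgeConjecture.Theorems.F0P3cDyRamToricLevelCensusRamK   -- ★ T5b HEAD (this seat) ED. 2: `ncard_levelSet_…_of_ramK_aniso` (counts from depth-set equations); brings ★ p857459, ★ B2
import Literature.NumberTheory.LocalFields.QuadraticOrderTwistedDepthMembers             -- ★ p857698 (this seat, B3): twisted depth sets inhabited iff `c + 2 ≤ 2d`
import Literature.NumberTheory.LocalFields.QuadraticDatumAntiFixedUnitSplitting           -- ★ (this seat, B5): `h = h₊·n₀` splitting, anisotropic ⇒ `n₀` non-norm
import HarnessLib

/-!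
# (ρ2b′-X) T5b — the toric level census of type RamK: THE EXPLICIT ANISOTROPIC TABLE `n₋(j,a)` (sheet (S4) `ncard_levelSet_ramK_aniso`)

`Summits/HodgeConjecture/HodgeConjecture/Theorems/F0P3cDyRamToricLevelCensusRamKAniso.lean`, namespace `Summit.HodgeConjecture.HodgeConjecture.Cruxes.H413.F0P3cDyRamToricLevelCensusRamK`
(the T5b HEAD's namespace, third file; sister of ★ `…RamKHyper`).  PROOF FILE of a SUPPORT
organ (helper leaf `--supports stmt-HodgeConjecture-24833 --as helper`; no stub credit claimed; hodgecm-mathlib-F0P3-p01 (g32) for the (ρ2b′-X) payer LH4-p14's lineage, dealer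
LH4-plan (g12) WORD #16 «T5b = TORIC LEVEL CENSUS type RamK»).  THEOREMS ONLY (no `def`, no instance, no notation, no sorry).
TYPE RamK: `K∕F` ramified, the third field `K♮ = Fix Θ` UNRAMIFIED over `F`, so `M∕E` is unramified (uniformiser `ϖE`, `ρϖE = ϖE`) and `M∕K♮` is RAMIFIED with the datum
`(Θ, ϖE, d, t)`; `K♮` is handed over as a valued field `K'` with `jK : K' →+* M` onto `Fix Θ` (`|jK x| = |x|²`, `jK∘σ' = ρ∘jK`, `K'∕Fix σ'` unramified: `|α' − σ'α'| = 1`),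
both residue fields of `q²` elements.  THIS FILE: **`ncard_levelSet_ramK_aniso`** — for an ANISOTROPIC side scalar `h` (`Θh = h`, no isotropic vector) the number of order lattices `x₀·𝒪_j` with an
integral Gram-primitive dual generator of level `a` is the sheet's (S4) if-then-else table in `(q, d, j, a)` (docstring): split `h = h₊·n₀` (★ B5, unit Hilbert 90 on `K'`),
`n₀` is a non-norm `Θ`-fixed unit (anisotropy), the depth sets are cosets or empty according to `c + 2 ≤ 2d` (★ B3, hFN discharged by ★ p857442), the counts are
`[B_c : 𝒪_jˣ] − [B_{c+1} : 𝒪_jˣ]` ∕ `[B_c : 𝒪_jˣ]` ∕ `0` (★ HEAD ED. 2), and the indices are `|G_j| = (q+1)q^{j−1}`, `[U : B_c] = idxRK` (★ p857459; only FULL-regime indices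
occur on this side).  `v(h)` is even, the parity gate is `j ≡ a (2)`.  The table equals the index-form arithmetic (exact rationals, `q ≤ 9`, `d ≤ 5`, `j ≤ 13`).
HONEST LABEL: HC_CM is proved only modulo the 7 printed citations (2 remaining named inputs: hLiu418 = stmt-HodgeConjecture-24832, h413 = stmt-HodgeConjecture-24833) until rung 0
closes; this leaf is unconditional local algebra and count-neutral.

## References
* [Flicker1998UnitaryFL] Y. Flicker, Prop. 7 p. 84 (torus-orbit census on the tree).
* [Jacobowitz1962] R. Jacobowitz, *Hermitian forms over local fields*, Amer. J. Math. 84 (1962): §4.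
* [Serre1979] J.-P. Serre, *Local Fields*, GTM 67 (1979): Ch. V §1, §3.
-/

set_option autoImplicit false

namespace Summit.HodgeConjecture.HodgeConjecture.Cruxes.H413.F0P3cDyRamToricLevelCensusRamK

open WithZero
open scoped Pointwise Valued
open Literature.NumberTheory.LocalFields.QuadraticOrder
open Summit.HodgeConjecture.HodgeConjecture.Cruxes.H413.F0P3cDyRamToricCensusDefs

variable {K : Type} [Field K] [Valued K ℤᵐ⁰] {ρ Θ : K →+* K} {α ϖE h : K}
variable {K' : Type} [Field K'] [Valued K' ℤᵐ⁰] {σ' : K' →+* K'} {α' π' : K'}   -- the third field `K' ≅ K♮ = Fix Θ`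

/-! ## §1 THE EXPLICIT ANISOTROPIC TABLE `n₋(j,a)` of type RamK (sheet (S4) `ncard_levelSet_ramK_aniso`), two-field frame, binder-free -/

open Literature.NumberTheory.Automorphic.UnitaryThreeFourFrame Literature.NumberTheory.LocalFields.WildQuadraticDatum in
/-- **THE ANISOTROPIC RamK LEVEL TABLE (sheet (S4))**: for an anisotropic side `h` (`Θh = h`), with `c = j − a`:
`#L_h(j,a) = 1∕0` (`j = 0`, `a = 0` ∕ `a ≥ 1`); `0` if `j < a` or `c` odd; `q^j` (`a = j`, `d ≥ 2`) ∕ `(q+1)q^{j−1}` (`a = j`, `d = 1`); `q^{j∕2}` ∕ `0` (`a = 0`, `j + 2 ≤ 2d` ∕ not);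
`(q−1)q^{j−1−c∕2}` (`c + 2 < 2d`); `q^{j−d+1}` (`c + 2 = 2d`); `0` (`c + 2 > 2d`). [cite: Flicker1998UnitaryFL, Prop. 7 p. 84] [cite: Jacobowitz1962, §4] [cite: Serre1979, Ch. V §3] -/
theorem ncard_levelSet_ramK_aniso [CompleteSpace K] [IsDiscreteValuationRing 𝒪[K]] [Finite 𝓀[K]]
    [CompleteSpace K'] [IsDiscreteValuationRing 𝒪[K']] [Finite 𝓀[K']]
    (hρρ : ∀ x, ρ (ρ x) = x) (hvρ : ∀ x, Valued.v (ρ x) = Valued.v x) (hΘρ : ∀ x, Θ (ρ x) = ρ (Θ x))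
    (hα1 : Valued.v α ≤ 1) (hα : Valued.v (α - ρ α) = 1) {d t : ℕ} (hD : IsRamifiedQuadraticDatum Θ ϖE d t) (hρϖ : ρ ϖE = ϖE)
    (hΘh : Θ h = h) (hh : h ≠ 0) {q : ℕ} (hq : Nat.card 𝓀[K] = q ^ 2)
    (hσ' : ∀ x, σ' (σ' x) = x) (hvσ' : ∀ x, Valued.v (σ' x) = Valued.v x) (hα'1 : Valued.v α' ≤ 1) (hα' : Valued.v (α' - σ' α') = 1)
    (hπ' : Valued.v π' = exp (-1 : ℤ)) (hq' : Nat.card 𝓀[K'] = q ^ 2)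
    (jK : K' →+* K) (hjv : ∀ x, Valued.v (jK x) = Valued.v x ^ 2) (hjΘ : ∀ x, Θ (jK x) = jK x) (hjfix : ∀ z : K, Θ z = z → ∃ x, jK x = z)
    (hjσ : ∀ x, jK (σ' x) = ρ (jK x))
    (haniso : ¬ ∃ x : K, x ≠ 0 ∧ h * Θ x * x + ρ (h * Θ x * x) = 0) (j a : ℕ) :
    (levelSet ρ Θ α ϖE h j a).ncard =
      if j = 0 then (if a = 0 then 1 else 0)
      else if j < a ∨ (j - a) % 2 = 1 then 0
      else if a = j then (if 2 ≤ d then q ^ j else (q + 1) * q ^ (j - 1))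
      else if a = 0 then (if j + 2 ≤ 2 * d then q ^ (j / 2) else 0)
      else if j - a + 2 < 2 * d then (q - 1) * q ^ (j - 1 - (j - a) / 2)
      else if j - a + 2 = 2 * d then q ^ (j - d + 1)
      else 0 := by
  classical
  have hvΘ : ∀ x, Valued.v (Θ x) = Valued.v x := hD.2.1
  have hϖE : Valued.v ϖE = exp (-1 : ℤ) := hD.2.2.1
  have hd : 1 ≤ d := hD.2.2.2.2.2.1
  have hq2 : 2 ≤ q := by
    have h1 : 1 < Nat.card 𝓀[K] := Finite.one_lt_card
    rw [hq] at h1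
    by_contra hlt
    interval_cases q <;> simp at h1
  have hq0 : 0 < q := by omega
  have hFN : ∀ f : K, ρ f = f → Θ f = f → Valued.v f = 1 → ∃ x : K, x * Θ x = f := fun f hρf hΘf hf =>
    exists_mul_map_eq_of_fixed_fixed_of_thirdField hρρ hvρ hΘρ hD hσ' hvσ' hα'1 hα' hπ' jK hjv hjΘ hjfix hjσ hρf hΘf hf
  -- (1) parity `v(h) = exp(−2k)` and the splitting `h = h₊·n₀` with `n₀` a non-norm `Θ`-fixed unit
  obtain ⟨s', hs'⟩ := hjfix h hΘh
  have hs'0 : s' ≠ 0 := by rintro rfl; rw [map_zero] at hs'; exact hh hs'.symm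
  obtain ⟨k, u', hu', hs'eq⟩ := exists_eq_varpi_zpow_mul_unit hπ' hs'0
  have hvh0 : Valued.v h = exp (-(2 * k)) := by
    rw [← hs', hjv, hs'eq, map_mul, hu', mul_one, (v_varpi_zpow hπ' k).2, sq, ← exp_add]
    congr 1; ring
  obtain ⟨hp, n₀, rfl, hρh, hhp, -, hΘn, hn1⟩ := exists_antiFixed_mul_unit_of_theta_fixed hσ' hvσ' hα'1 hα' jK hjv hjΘ hjfix hjσ hΘh hh
  have hvh : Valued.v (hp * n₀) = exp (-(2 * k)) := hvh0
  have hn0 : n₀ ≠ 0 := fun h0 => by rw [h0, map_zero] at hn1; exact zero_ne_one hn1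
  have hnN : ¬ ∃ ω : K, ω * Θ ω = n₀ := fun ⟨ω, hω⟩ => haniso (isotropic_of_mul_map_eq hρh hn0 hω)
  -- members ∕ non-members of the twisted depth sets (★ B3)
  have hmem : ∀ c : ℕ, c + 2 ≤ 2 * d → ∃ ω : Kˣ, Valued.v (ω : K) = 1 ∧
      Valued.v (n₀ * ((ω : K) * Θ ω) - ρ (n₀ * ((ω : K) * Θ ω))) ≤ exp (-(c : ℤ)) := fun c hc => by
    obtain ⟨ω, hω1, hωc⟩ := exists_twistedNormDepth_le_of_le hvρ hD hΘn hn1 hnN hc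
    have hω0 : ω ≠ 0 := fun h0 => by rw [h0, map_zero] at hω1; exact zero_ne_one hω1
    exact ⟨Units.mk0 ω hω0, by rw [Units.val_mk0]; exact hω1, by rw [Units.val_mk0]; exact hωc⟩
  have hnone : ∀ c : ℕ, 2 * d ≤ c + 1 → ∀ ω : K, Valued.v ω = 1 →
      ¬ Valued.v (n₀ * (ω * Θ ω) - ρ (n₀ * (ω * Θ ω))) ≤ exp (-(c : ℤ)) := fun c hc =>
    not_twistedNormDepth_le_of_le hρρ hvρ hα1 hα hΘρ hD hρϖ hFN hΘn hn1 hnN hc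
  have hmem0 : ∀ t' : ℤ, 0 ≤ t' → Valued.v (n₀ * (((1 : Kˣ) : K) * Θ ((1 : Kˣ) : K)) - ρ (n₀ * (((1 : Kˣ) : K) * Θ ((1 : Kˣ) : K)))) ≤ exp t' :=
    fun t' ht => by
      rw [Units.val_one, map_one, mul_one, mul_one]
      refine (Valuation.map_sub _ _ _).trans ?_
      rw [hvρ, hn1, max_self, ← exp_zero, exp_le_exp]; exact ht
  -- (2) the subgroups `U ⊇ B_c ⊇ H = 𝒪_jˣ` and their indices (only the FULL regime `c + 2 ≤ 2d` is needed on this side)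
  obtain ⟨U, hU⟩ := Literature.NumberTheory.LocalFields.WildQuadraticDatum.exists_subgroup_v_eq_one (K := K)
  obtain ⟨H, hH⟩ := exists_subgroup_orderUnits (ρ := ρ) (α := α) hvρ (ϖE ^ j)
  obtain ⟨Ut, hUt⟩ := exists_subgroup_thetaFixed_units (K := K) (Θ := Θ)
  have hvc : Valued.v (ϖE ^ j * (α - ρ α)) = exp (-(j : ℤ)) := by
    rw [map_mul, hα, mul_one, map_pow, hϖE, ← exp_nsmul, nsmul_eq_mul, mul_neg, mul_one]
  have hHU : H ≤ U := fun u hu => (hU u).2 ((hH u).1 hu).1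
  have hHrel : H.relIndex U = if j = 0 then 1 else (q + 1) * q ^ (j - 1) := by
    split_ifs with hj0
    · subst hj0
      rw [Subgroup.relIndex_eq_one]
      intro u hu
      rw [hH]
      refine ⟨(hU u).1 hu, ?_⟩
      rw [hvc]
      refine (Valuation.map_sub _ _ _).trans ?_
      rw [hvρ, (hU u).1 hu, max_self]; norm_num
    · have hH' : ∀ u, u ∈ H ↔ Valued.v (u : K) = 1 ∧ Valued.v ((u : K) - ρ u) ≤ Valued.v (ϖE ^ j) := fun u => by
        rw [hH u, map_mul Valued.v (ϖE ^ j), hα, mul_one]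
      exact relIndex_orderUnits_eq_of_unramified hρρ hvρ hα1 hα hϖE hq (Nat.one_le_iff_ne_zero.2 hj0) U H hU hH'
  have hHU0 : H.relIndex U ≠ 0 := by
    rw [hHrel]; split_ifs
    · exact one_ne_zero
    · exact mul_ne_zero (by omega) (pow_ne_zero _ hq0.ne')
  have hBk : ∀ c : ℕ, ∃ B : Subgroup Kˣ,
      (∀ ω, ω ∈ B ↔ Valued.v (ω : K) = 1 ∧ Valued.v ((ω : K) * Θ ω - ρ ((ω : K) * Θ ω)) ≤ exp (-(c : ℤ))) ∧
      (B.relIndex U = if c = 0 then 1 else if c + 2 ≤ 2 * d then (q + 1) * q ^ ((c + 1) / 2 - 1) else (q + 1) * q ^ ((c + 1) / 2 - 1) / 2) ∧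
      B ≤ U ∧ (c ≤ j → H ≤ B) := fun c => by
    obtain ⟨B, hB⟩ := exists_subgroup_normDepth (Θ := Θ) hvρ hvΘ (exp (-(c : ℤ)))
    obtain ⟨Vt, hVt⟩ := exists_subgroup_thetaFixed_depth (K := K) (Θ := Θ) hvρ (exp (-(c : ℤ)))
    refine ⟨B, hB, relIndex_normDepth_eq_of_ramK hρρ hvρ hα1 hα hΘρ hD hρϖ hσ' hvσ' hα'1 hα' hπ' hq' jK hjv hjΘ hjfix hjσ c U Ut Vt B hU hUt hVt hB,
      fun ω hω => (hU ω).2 ((hB ω).1 hω).1, fun hcj => ?_⟩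
    exact orderUnits_le_normDepth hvρ hΘρ hvΘ (by rw [hvc, exp_le_exp]; omega) hH hB
  have hfinB : ∀ (g : Kˣ) (B : Subgroup Kˣ), H ≤ B → B ≤ U → ((QuotientGroup.mk : Kˣ → Kˣ ⧸ H) '' (g • (B : Set Kˣ))).Finite := fun g B hHB hBU => by
    apply Set.finite_of_ncard_ne_zero
    rw [ncard_image_mk_smul_subgroup H B g]
    have hmul := Subgroup.relIndex_mul_relIndex H B U hHB hBU
    exact left_ne_zero_of_mul (hmul.symm ▸ hHU0)
  -- (3) the count
  by_cases hpar : (j + a) % 2 = 0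
  swap
  · -- ODD PARITY (`v(h)` is even): empty
    rw [ncard_levelSet_eq_zero_of_odd_ramK hvρ hvΘ hα hϖE hvh j a (fun k' hk' => by omega) H hH]
    by_cases hj0 : j = 0
    · subst hj0; rw [if_pos rfl, if_neg (by omega)]
    · rw [if_neg hj0, if_pos (by omega : j < a ∨ (j - a) % 2 = 1)]
  by_cases ha0 : a = 0
  · -- LEVEL 0: `[B_j : H]` if the depth set at `j` is inhabited (`j + 2 ≤ 2d`), else `0`
    subst ha0
    by_cases hjd : j + 2 ≤ 2 * d
    · obtain ⟨B, hB, hBU, hBle, hHB⟩ := hBk j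
      obtain ⟨ω₁, hω₁, h₁⟩ := hmem j hjd
      rw [ncard_levelSet_zero_eq_relIndex_of_ramK_aniso hρρ hvρ hΘρ hvΘ hα hϖE hρϖ hhp hρh hn1 hvh j (k₀ := -k - ((j / 2 : ℕ) : ℤ))
        (by push_cast; omega) H B hH hB hω₁ h₁]
      have hmul := Subgroup.relIndex_mul_relIndex H B U (hHB le_rfl) hBle
      rw [hHrel] at hmul
      by_cases hj0 : j = 0
      · subst hj0
        rw [if_pos rfl, if_pos rfl]
        rw [hBU, if_pos rfl, if_pos rfl, mul_one] at hmul
        exact hmul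
      rw [if_neg hj0, if_neg (by omega), if_neg (fun h0 => hj0 h0.symm), if_pos rfl, if_pos hjd]
      rw [if_neg hj0, hBU, if_neg hj0, if_pos hjd] at hmul
      have he : (j + 1) / 2 - 1 + j / 2 = j - 1 := by omega
      refine Nat.eq_of_mul_eq_mul_right (show 0 < (q + 1) * q ^ ((j + 1) / 2 - 1) from mul_pos (by omega) (pow_pos hq0 _)) ?_
      rw [hmul, ← he, pow_add]; ring
    · have hj0 : j ≠ 0 := by omega
      rw [ncard_levelSet_zero_eq_zero_of_ramK_aniso hρρ hvρ hΘρ hvΘ hα hϖE hρϖ hhp hρh hn1 hvh j (k₀ := -k - ((j / 2 : ℕ) : ℤ))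
        (by push_cast; omega) H hH (hnone j (by omega))]
      rw [if_neg hj0, if_neg (by omega), if_neg (fun h0 => hj0 h0.symm), if_pos rfl, if_neg hjd]
  have ha1 : 1 ≤ a := Nat.one_le_iff_ne_zero.2 ha0
  by_cases haj : a ≤ j
  · -- 1 ≤ a ≤ j, c = j − a even
    have hj0 : j ≠ 0 := by omega
    obtain ⟨B, hB, hBU, hBle, hHB⟩ := hBk (j - a)
    obtain ⟨B', hB', hB'U, hB'le, hHB'⟩ := hBk (j - a + 1)
    have e1 : (-((j - a : ℕ) : ℤ)) = -((j : ℤ) - a) := by omega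
    have e2 : (-((j - a + 1 : ℕ) : ℤ)) = -((j : ℤ) - a + 1) := by omega
    have hBD : ∀ ω : Kˣ, ω ∈ B ↔ Valued.v (ω : K) = 1 ∧ Valued.v ((ω : K) * Θ ω - ρ ((ω : K) * Θ ω)) ≤ exp (-((j : ℤ) - a)) :=
      fun ω => by rw [hB ω, e1]
    have hB'D : ∀ ω : Kˣ, ω ∈ B' ↔ Valued.v (ω : K) = 1 ∧ Valued.v ((ω : K) * Θ ω - ρ ((ω : K) * Θ ω)) ≤ exp (-((j : ℤ) - a + 1)) :=
      fun ω => by rw [hB' ω, e2]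
    have hmul := Subgroup.relIndex_mul_relIndex H B U (hHB (by omega)) hBle
    have hmul' := Subgroup.relIndex_mul_relIndex H B' U (hHB' (by omega)) hB'le
    rw [hHrel, if_neg hj0] at hmul hmul'
    rw [if_neg hj0, if_neg (by omega)]
    by_cases hlt : j - a + 2 < 2 * d
    · -- both depth sets inhabited: `[B_c : H] − [B_{c+1} : H]`, both indices FULL
      obtain ⟨ω₂, hω₂, h₂⟩ := hmem (j - a + 1) (by omega)
      rw [e2] at h₂
      rw [ncard_levelSet_eq_relIndex_sub_of_ramK_aniso hρρ hvρ hΘρ hvΘ hα hϖE hρϖ hhp hρh hn1 hvh j ha1 (k₀ := -k + (((j + a) / 2 : ℕ) : ℤ) - j)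
        (by push_cast; omega) H B B' hH hBD hB'D (hHB' (by omega)) hω₂ h₂ (hfinB ω₂ B (hHB (by omega)) hBle)]
      by_cases hja : a = j
      · -- c = 0 (then `d ≥ 2`): `|G_j| − q^{j−1} = q^j`
        subst hja
        rw [if_pos rfl, if_pos (by omega)]
        rw [hBU, if_pos (Nat.sub_self a), mul_one] at hmul
        simp only [Nat.sub_self, zero_add, Nat.reduceAdd, Nat.reduceDiv, pow_zero, mul_one] at hB'U
        rw [hB'U, if_neg one_ne_zero, if_pos (by omega)] at hmul'
        have hX' : H.relIndex B' = q ^ (a - 1) := by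
          refine Nat.eq_of_mul_eq_mul_right (show 0 < q + 1 by omega) ?_
          rw [hmul']; ring
        have hpow : q ^ a = q * q ^ (a - 1) := by rw [← pow_succ']; congr 1; omega
        rw [hmul, hX', hpow]
        have hle : q ^ (a - 1) ≤ (q + 1) * q ^ (a - 1) := Nat.le_mul_of_pos_left _ (by omega)
        zify [hle]; ring
      · -- 2 ≤ c: `(q−1)q^{j−1−c∕2}`
        have hc2 : 2 ≤ j - a := by omega
        rw [if_neg hja, if_neg ha0, if_pos hlt]
        have hcne : j - a ≠ 0 := by omega
        have hcne' : j - a + 1 ≠ 0 := by omega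
        have he : (j - a + 1) / 2 - 1 = (j - a) / 2 - 1 := by omega
        have he' : (j - a + 1 + 1) / 2 - 1 = (j - a) / 2 := by omega
        rw [hBU, if_neg hcne, if_pos (by omega), he] at hmul
        rw [hB'U, if_neg hcne', if_pos (by omega), he'] at hmul'
        have hpow1 : q ^ (j - 1) = q * q ^ (j - 1 - (j - a) / 2) * q ^ ((j - a) / 2 - 1) := by
          rw [← pow_succ', ← pow_add]; congr 1; omega
        have hpow2 : q ^ (j - 1) = q ^ (j - 1 - (j - a) / 2) * q ^ ((j - a) / 2) := by
          rw [← pow_add]; congr 1; omega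
        have hX : H.relIndex B = q * q ^ (j - 1 - (j - a) / 2) := by
          refine Nat.eq_of_mul_eq_mul_right (show 0 < (q + 1) * q ^ ((j - a) / 2 - 1) from mul_pos (by omega) (pow_pos hq0 _)) ?_
          rw [hmul, hpow1]; ring
        have hX' : H.relIndex B' = q ^ (j - 1 - (j - a) / 2) := by
          refine Nat.eq_of_mul_eq_mul_right (show 0 < (q + 1) * q ^ ((j - a) / 2) from mul_pos (by omega) (pow_pos hq0 _)) ?_
          rw [hmul', hpow2]; ring
        rw [hX, hX', Nat.sub_mul, one_mul]
    by_cases heq : j - a + 2 = 2 * d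
    · -- outer inhabited, inner empty: `[B_c : H]`
      obtain ⟨ω₁, hω₁, h₁⟩ := hmem (j - a) (by omega)
      rw [e1] at h₁
      have hnone' : ∀ ω : K, Valued.v ω = 1 → ¬ Valued.v (n₀ * (ω * Θ ω) - ρ (n₀ * (ω * Θ ω))) ≤ exp (-((j : ℤ) - a + 1)) := by
        rw [← e2]; exact hnone (j - a + 1) (by omega)
      rw [ncard_levelSet_eq_relIndex_of_ramK_aniso hρρ hvρ hΘρ hvΘ hα hϖE hρϖ hhp hρh hn1 hvh j ha1 (k₀ := -k + (((j + a) / 2 : ℕ) : ℤ) - j)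
        (by push_cast; omega) H B hH hBD hω₁ h₁ hnone']
      by_cases hja : a = j
      · -- c = 0, d = 1: `|G_j|`
        subst hja
        rw [if_pos rfl, if_neg (by omega)]
        rw [hBU, if_pos (Nat.sub_self a), mul_one] at hmul
        exact hmul
      · have hc2 : 2 ≤ j - a := by omega
        rw [if_neg hja, if_neg ha0, if_neg hlt, if_pos heq]
        have hcne : j - a ≠ 0 := by omega
        have he : (j - a + 1) / 2 - 1 = (j - a) / 2 - 1 := by omega
        rw [hBU, if_neg hcne, if_pos (by omega), he] at hmul
        have hpow1 : q ^ (j - 1) = q * q ^ (j - 1 - (j - a) / 2) * q ^ ((j - a) / 2 - 1) := by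
          rw [← pow_succ', ← pow_add]; congr 1; omega
        have hX : H.relIndex B = q * q ^ (j - 1 - (j - a) / 2) := by
          refine Nat.eq_of_mul_eq_mul_right (show 0 < (q + 1) * q ^ ((j - a) / 2 - 1) from mul_pos (by omega) (pow_pos hq0 _)) ?_
          rw [hmul, hpow1]; ring
        rw [hX, ← pow_succ']; congr 1; omega
    · -- outer empty: `0`
      have hnone' : ∀ ω : K, Valued.v ω = 1 → ¬ Valued.v (n₀ * (ω * Θ ω) - ρ (n₀ * (ω * Θ ω))) ≤ exp (-((j : ℤ) - a)) := by
        rw [← e1]; exact hnone (j - a) (by omega)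
      rw [ncard_levelSet_eq_zero_of_ramK_aniso hρρ hvρ hΘρ hvΘ hα hϖE hρϖ hhp hρh hn1 hvh j ha1 (k₀ := -k + (((j + a) / 2 : ℕ) : ℤ) - j)
        (by push_cast; omega) H hH hnone']
      have hja : a ≠ j := by omega
      rw [if_neg hja, if_neg ha0, if_neg hlt, if_neg heq]
  · -- a > j: both depth conditions are vacuous on units (`ω₂ = 1` is a member), `[U : H] − [U : H] = 0`
    have hvac : ∀ (t' : ℤ), 0 ≤ t' → ∀ ω : Kˣ, Valued.v (ω : K) = 1 →
        Valued.v ((ω : K) * Θ ω - ρ ((ω : K) * Θ ω)) ≤ exp t' := fun t' ht ω hω => by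
      have hvN' : Valued.v ((ω : K) * Θ ω) = 1 := by rw [map_mul, hvΘ, hω, mul_one]
      refine (Valuation.map_sub _ _ _).trans ?_
      rw [hvρ, hvN', max_self, ← exp_zero, exp_le_exp]; exact ht
    have hUD : ∀ ω : Kˣ, ω ∈ U ↔ Valued.v (ω : K) = 1 ∧ Valued.v ((ω : K) * Θ ω - ρ ((ω : K) * Θ ω)) ≤ exp (-((j : ℤ) - a)) :=
      fun ω => by rw [hU ω]; exact ⟨fun h1 => ⟨h1, hvac _ (by omega) ω h1⟩, fun h1 => h1.1⟩
    have hUD' : ∀ ω : Kˣ, ω ∈ U ↔ Valued.v (ω : K) = 1 ∧ Valued.v ((ω : K) * Θ ω - ρ ((ω : K) * Θ ω)) ≤ exp (-((j : ℤ) - a + 1)) :=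
      fun ω => by rw [hU ω]; exact ⟨fun h1 => ⟨h1, hvac _ (by omega) ω h1⟩, fun h1 => h1.1⟩
    rw [ncard_levelSet_eq_relIndex_sub_of_ramK_aniso hρρ hvρ hΘρ hvΘ hα hϖE hρϖ hhp hρh hn1 hvh j ha1 (k₀ := -k + (((a + j) / 2 : ℕ) : ℤ) - j)
      (by push_cast; omega) H U U hH hUD hUD' hHU (ω₂ := 1) (by rw [Units.val_one, map_one]) (hmem0 _ (by omega))
      (hfinB 1 U hHU le_rfl), Nat.sub_self]
    by_cases hj0 : j = 0
    · subst hj0; rw [if_pos rfl, if_neg ha0]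
    · rw [if_neg hj0, if_pos (Or.inl (by omega))]

end Summit.HodgeConjecture.HodgeConjecture.Cruxes.H413.F0P3cDyRamToricLevelCensusRamK
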